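import Literature.MathematicalPhysics.QuantumLattice.FermiRG.FST2SecondOrderStrings
import Literature.MathematicalPhysics.QuantumLattice.FermiRG.FST2TubularCoordsConstruction
import Mathlib.Analysis.Calculus.LocalExtr.Basic
import Mathlib.Analysis.Calculus.Deriv.MeanValue
import Mathlib.Analysis.Calculus.ContDiff.Bounds
import Mathlib.Analysis.Normed.Group.Bounded
import Mathlib.Analysis.Normed.Operator.Prod
import HarnessLib

/-!
# Feldman–Salmhofer–Trubowitz II: the scale decomposition `C_{<0} = Σ_{j<0} C_j` and the slice bounds (shellj)

Topic `Literature/MathematicalPhysics/QuantumLattice/FermiRG`. A PROOF COMPANION (theorems only: no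
definitions, no named facts) of `FST2SecondOrderStrings.lean` (gate-hubbard-kl wave file F4c), whose §1
records as DATA the scale parameter and cutoff `ScaleCutoff M` (`a ∈ C^∞`, `a = 0` on `x ≤ M⁻⁴`,
`a = 1` on `x ≥ M⁻²`, `a' > 0` in between), the slice function `sliceFn` `f(x) = a(x) - a(x/M²)`,
the infrared covariance `covIR` `C_{<0} = (1 - a)C` and the slice propagators `covSlice`
`C_j = f(M^{-2j}(p₀² + E²))/(ip₀ - E)`, and lists under "What is NOT here" the bound (shellj). Sources:

* [II] J. Feldman, M. Salmhofer, E. Trubowitz, *Perturbation theory around non-nested Fermi surfaces II*,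
  Comm. Pure Appl. Math. **51** (1998) 1133–1246, arXiv:cond-mat/9701073
  (`FeldmanSalmhoferTrubowitz1998`), §2.4–2.5, p.10 L56–63 and p.11 L1–29 (locators = chunks/lines of
  the `lit read arxiv:cond-mat/9701073` render of the arXiv TeX): "Let `f(x) = a(x) - a(x/M²)`, then
  `1 - a(x) = Σ_{j<0} f(M^{-2j}x)`, and `C_{<0}(p₀,E) = (1 - a(p₀²+E²))/(ip₀ - E) = Σ_{j<0} C_j(p₀,E)`,
  `C_j(p₀,E) = f(M^{-2j}(p₀²+E²))/(ip₀ - E)` (CpzE) … it is easy to prove (see [I], Lemmas 2.1 and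
  2.3) that `max_{|α|=s} |D^α C_j(p₀, e(p))| ≤ W_s M^{-(s+1)j} 𝟙(|ip₀ - e(p)| ≤ M^j)` (shellj) … In
  words: on 'slice' number `j`, the propagator is for all `(p₀, p)` of absolute value at most
  `M^{2-j}` (`s = 0` in (shellj); `W₀ = M²`) … the support of `C_j` is contained in the product of an
  interval of length `2M^j` in `p₀` and a thin shell of thickness `M^j` around the Fermi surface".
* [I] J. Feldman, M. Salmhofer, E. Trubowitz, *Perturbation theory around non-nested Fermi surfaces I*,
  J. Stat. Phys. **84** (1996) 1209–1336, arXiv:cond-mat/9509006 (`FeldmanSalmhoferTrubowitz1996`),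
  §2 "Scale Decomposition and Power Counting" (render `paper:arxiv-cond-mat_9509006`, p.14 L34–137):
  eq. (cutfdef) "`f(x) = a(x) - a(x/M²) = {0 if x ≤ M⁻⁴; a(x) if M⁻⁴ ≤ x ≤ M⁻²; 1 - a(x/M²) if
  M⁻² ≤ x ≤ 1; 0 if x ≥ 1}`, so that, for all `x > 0`, `f(x) ≥ 0` and `1 - a(x) = Σ_{j=-∞}^{-1}
  f(M^{-2j}x)` (prtunity). Calling `f_j(x) = f(M^{-2j}x)`, `supp f_j = [M^{2j-4}, M^{2j}]`, and for all
  `x ≥ 0`, `f_j(x) f_{j'}(x) = 0` if `|j - j'| ≥ 2` (Nullzwei)" (p.14 L63–73), and the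
  lemma (i) "`|C_j(p₀, e(p))| ≤ M^{-j+2} 𝟙(|ip₀ + e(p)| ∈ [M^{j-2}, M^j])`" (p.14 L97–104; the lemma
  [II] cites as "[I], Lemma 2.3").

## What is proved (all for a cutoff `χ : ScaleCutoff M`; `1 < M` where the shape of `a` is used)

* `ScaleCutoff.monotone` — `a` is monotone (`a' ≥ 0`: positive on `(M⁻⁴, M⁻²)`, zero where `a` is
  locally extremal); `sliceFn_nonneg`, `sliceFn_le_one` — `0 ≤ f ≤ 1`;
* (cutfdef): `sliceFn_eq_zero_of_le` (`x ≤ M⁻⁴`), `sliceFn_eq_of_le` (`= a(x)` on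
  `x ≤ M⁻²`), `sliceFn_eq_one_sub_of_le` (`= 1 - a(x/M²)` on `x ≥ M⁻²`),
  `sliceFn_eq_zero_of_one_le` (`x ≥ 1`); `lt_and_lt_of_sliceFn_ne_zero` (`supp f ⊆ (M⁻⁴, 1)`);
* (prtunity): `hasSum_sliceFn` — for `x > 0`, `Σ_{n ≥ 0} f(M^{2(n+1)} x) = 1 - a(x)` (the index
  `j < 0` of [I], [II] is `j = -(n+1)`; the sum is finite: a telescope that stabilises once
  `M^{2N} x ≥ M⁻²`);
* (CpzE): `hasSum_covSlice` — `Σ_{n ≥ 0} C_{-(n+1)}(p₀, E) = C_{<0}(p₀, E)` for ALL `(p₀, E)` (at the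
  origin both sides vanish by the junk value `C(0,0) = 0` and `f(0) = 0`);
* the support of the slice: `sq_lt_of_covSlice_ne_zero` — `C_j(p₀,E) ≠ 0 ⇒ M^{2j-4} < p₀² + E² < M^{2j}`
  ([I] (i): `|ip₀ - E| ∈ (M^{j-2}, M^j)`), `lt_and_lt_of_sliceFn_mul_ne_zero` (`supp f_j`), and
  (Nullzwei) of [I] (p.14 L69–73): `sliceFn_mul_sliceFn_eq_zero` / `covSlice_mul_covSlice_eq_zero` —
  `f_j f_{j'} = 0` and `C_j C_{j'} = 0` when `|j - j'| ≥ 2`;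
* (shellj) at `s = 0` with the printed constant `W₀ = M²`: `norm_covSlice_le` —
  `|C_j(p₀, E)| ≤ M² · M^{-j} · 𝟙(p₀² + E² ≤ M^{2j})` for every `j ∈ ℤ` and all `(p₀, E)` (in
  particular for `E = e(p)`); `norm_covSlice_le_rpow` — the same with the real power `M^{-(j:ℝ)}` of
  the (onlyyou) hypothesis shape of `StringsTheorem`;
* (shellj) at all orders: `covSlice_eq_smul_covSlice_zero` (scaling `C_j = M^{-j} C_0 ∘ (M^{-j}·)`),
  `contDiff_covSlice` (the slices are `C^∞` on `ℝ²`), `hasCompactSupport_covSlice_zero`,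
  `tsupport_covSlice_subset` (closed support in the shell), `exists_norm_iteratedFDeriv_covSlice_le`
  (`‖D^s C_j(p₀,E)‖ ≤ W_s M^{-(s+1)j} 𝟙`, all `s`, all `j ∈ ℤ`, `W_s = sup ‖D^s C_0‖`), and the printed
  form with the band inserted, `exists_norm_iteratedFDeriv_covSlice_comp_le`
  (`‖D^s[C_j(p₀, e(𝐩))]‖ ≤ W_s M^{-(s+1)j} 𝟙(|ip₀ - e(𝐩)| ≤ M^j)` for `s ≤ k`, `j ≤ 0`, `e ∈ C^k` with
  bounded derivatives; Faà di Bruno via Mathlib's `norm_iteratedFDeriv_comp_le`);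
* the string half of [II]'s derivation of Lemma 3.1 from Theorem 3.5 (p.21 L14–28):
  `HypA2.exists_norm_iteratedFDeriv_le` (under (A2)_{k,h} the derivatives of `e` of orders `1..k` are
  bounded) and `covSlice_string_hypotheses` — for (A2)_{k,h}, any coordinate datum
  `Φ : TubularCoords cr e k r₀` and `M > 1` there is ONE increasing family `Γ_s ≥ 0` such that every
  string `S(p₀, 𝐩) = C_j(p₀, e(𝐩))`, `j ≤ 0`, is `C^{k-1}`, `Γ#`-periodic and satisfies (onlyyou) and
  (thunif) with `ν = 1` in the hypothesis shapes of `FST2SecondOrderStrings.StringsTheorem` ("Obviously,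
  then, `∂_θ S^{(3)}(p₀, 𝐩(ρ,θ)) = 0`, so (thunif) holds, and (onlyyou) holds with `Γ_{3,1,s} = W_s`").

* [I] Lemma 2.3 (ii) in `d = 2` (p.14 L106–129): `TubularCoords.exists_volume_shell_le` — for any
  coordinate datum `Φ : TubularCoords cr e k r₀` (`k ≥ 1`) and a measurable fundamental domain `F`
  there is `C ≥ 0` with `vol{q ∈ F : |e(q)| ≤ ε} ≤ C ε` for `0 ≤ ε ≤ r₀` (the change of variables
  `q = p(ρ,θ)`: `F` is a fundamental domain for `Γ#`, the shell is covered by the translates of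
  `p([-ε,ε] × [0,2π])`, and the area formula `MeasureTheory.addHaar_image_le_lintegral_abs_det_fderiv`
  bounds the image by `sup|J|·4πε`; `C` plays the printed `A/u₀`), and
  `TubularCoords.exists_lintegral_covSlice_le` — (Cjpbd)/(Kzerodef) `∫_{ℝ×F} |C_j(p₀, e(𝐩))| ≤ K₀ M^j`
  with `K₀ = 2CM²`, for every `j` with `M^j ≤ r₀`; datum-free forms for every band of [II] §2 in
  `d = 2` ((A2)_{k,h}, `k ≥ 2`, (A3) global, `GeomConstants e K r₀ g₀ wmin`, through
  `nonempty_tubularCoords` of `FST2TubularCoordsConstruction.lean`):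
  `exists_volume_shell_le_of_geomConstants` (`ε ≤ r₀/2`) and
  `exists_lintegral_covSlice_le_of_geomConstants` (`M^j ≤ r₀/2`).

## What is NOT here

* The Jacobian bounds of [I, Lemma 2.1 (iv)] as printed (`|J| ≤ A₀/u₀`, `|∂J| ≤ A₁/u₀²`: here only
  `sup|J| < ∞` on the half-strip is used); the amplitude half of the derivation of Lemma 3.1 from Theorem 3.5
  ((dochzitiert) p.21 L1–13: one `θ`-derivative under the integral sign, the amplitudes
  `A = ∂_θ P_π` and `A = P_π ∂_θ e_b`, which need the inverse of the coordinate map, and the `ν = 2`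
  string `∂_e C_j`); the dependence "`W_s` depends on `|e|_s` and on `g₀`" is realised as: `W_s`
  depends on `M`, the cutoff `a` and the derivative bound `K` of `e` (no `g₀` is needed for (shellj)
  itself — `g₀` enters [II]'s `W_s` only through the angular derivatives (thunif), not treated here).
* Nothing about a model; nothing in this file asserts or denies the Kohn–Luttinger hypothesis H1.
-/

noncomputable section

open Set Filter
open scoped Topology NNReal

namespace Literature.MathematicalPhysics.QuantumLattice.FermiRG

namespace ScaleCutoff

variable {M : ℝ} (χ : ScaleCutoff M)

/-! ### The cutoff `a` and the slice function `f` [II §2.4–2.5; I (cutadef), (cutfdef)] -/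

/-- A cutoff datum forces `M² > 1` (for `M² ≤ 1` the requirements `a = 0` on `x ≤ M⁻⁴` and `a = 1`
on `x ≥ M⁻²` clash at `x = M⁻⁴`). [cite: FeldmanSalmhoferTrubowitz1998, §2.4 (arXiv p.10 L56-59)] -/
theorem one_lt_sq (χ : ScaleCutoff M) : 1 < M ^ 2 := by
  by_contra hle
  push Not at hle
  have h4 : M ^ 4 = M ^ 2 * M ^ 2 := by ring
  have hsq : 0 ≤ M ^ 2 := sq_nonneg M
  have h42 : M ^ 4 ≤ M ^ 2 := by rw [h4]; nlinarith
  -- at `x = (M⁴)⁻¹` both clauses apply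
  have hx : (M ^ 2)⁻¹ ≤ (M ^ 4)⁻¹ := by
    rcases hsq.eq_or_lt with h0 | h0
    · have : M ^ 4 = 0 := by rw [h4, ← h0]; ring
      rw [← h0, this]
    · exact inv_anti₀ (by rw [h4]; positivity) h42
  have h0 := χ.eq_zero ((M ^ 4)⁻¹) le_rfl
  have h1 := χ.eq_one ((M ^ 4)⁻¹) hx
  rw [h0] at h1
  exact zero_ne_one h1

/-- `0 ≤ a ≤ 1`. [cite: FeldmanSalmhoferTrubowitz1998, §2.4 (arXiv p.10 L57)] -/
theorem a_nonneg (x : ℝ) : 0 ≤ χ.a x := (χ.mem_Icc x).1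

/-- `0 ≤ a ≤ 1`. [cite: FeldmanSalmhoferTrubowitz1998, §2.4 (arXiv p.10 L57)] -/
theorem a_le_one (x : ℝ) : χ.a x ≤ 1 := (χ.mem_Icc x).2

/-- `a' ≥ 0` everywhere: positive on `(M⁻⁴, M⁻²)` by hypothesis, and zero at the points where
`a = 0 = min a` (`x ≤ M⁻⁴`) or `a = 1 = max a` (`x ≥ M⁻²`), which are local extrema.
[cite: FeldmanSalmhoferTrubowitz1998, §2.4 (arXiv p.10 L57-59)] -/
theorem deriv_a_nonneg (x : ℝ) : 0 ≤ deriv χ.a x := by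
  by_cases h1 : x ≤ (M ^ 4)⁻¹
  · have hmin : IsLocalMin χ.a x :=
      Eventually.of_forall fun y => by rw [χ.eq_zero x h1]; exact χ.a_nonneg y
    rw [hmin.deriv_eq_zero]
  by_cases h2 : (M ^ 2)⁻¹ ≤ x
  · have hmax : IsLocalMax χ.a x :=
      Eventually.of_forall fun y => by rw [χ.eq_one x h2]; exact χ.a_le_one y
    rw [hmax.deriv_eq_zero]
  push Not at h1 h2
  exact (χ.deriv_pos x h1 h2).le

/-- **`a` is monotone** (increasing). [cite: FeldmanSalmhoferTrubowitz1998, §2.4 (arXiv p.10 L57-59)] -/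
protected theorem monotone : Monotone χ.a :=
  monotone_of_deriv_nonneg (χ.contDiff.differentiable (by simp)) χ.deriv_a_nonneg

/-- `a = 0` on the whole half-line `x ≤ 0` as well (our extension of `a` by zero) and hence on
`x ≤ M⁻⁴`. [cite: FeldmanSalmhoferTrubowitz1998, §2.4 (arXiv p.10 L57-58)] -/
theorem a_div_sq_eq_zero_of_le (hM : 1 < M) {x : ℝ} (hx : x ≤ (M ^ 4)⁻¹) : χ.a (x / M ^ 2) = 0 := by
  refine χ.eq_zero _ ?_
  have hM2 : 1 ≤ M ^ 2 := by nlinarith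
  rcases le_or_gt 0 x with h0 | h0
  · exact (div_le_self h0 hM2).trans hx
  · exact le_of_lt ((div_neg_of_neg_of_pos h0 (by positivity)).trans_le (by positivity))

/-- (cutfdef), first case: `f(x) = 0` for `x ≤ M⁻⁴`.
[cite: FeldmanSalmhoferTrubowitz1996, §2 eq. (cutfdef) (arXiv p.14 L48-55)] -/
theorem sliceFn_eq_zero_of_le (hM : 1 < M) {x : ℝ} (hx : x ≤ (M ^ 4)⁻¹) : χ.sliceFn x = 0 := by
  rw [sliceFn, χ.eq_zero x hx, χ.a_div_sq_eq_zero_of_le hM hx, sub_zero]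

/-- (cutfdef), second case: `f(x) = a(x)` for `M⁻⁴ ≤ x ≤ M⁻²` (indeed for all `x ≤ M⁻²`).
[cite: FeldmanSalmhoferTrubowitz1996, §2 eq. (cutfdef) (arXiv p.14 L48-55)] -/
theorem sliceFn_eq_of_le (hM : 1 < M) {x : ℝ} (hx : x ≤ (M ^ 2)⁻¹) : χ.sliceFn x = χ.a x := by
  have hM2 : 0 < M ^ 2 := by positivity
  have h : χ.a (x / M ^ 2) = 0 := by
    refine χ.eq_zero _ ?_
    rw [div_le_iff₀ hM2]
    calc x ≤ (M ^ 2)⁻¹ := hx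
      _ = (M ^ 4)⁻¹ * M ^ 2 := by field_simp
  rw [sliceFn, h, sub_zero]

/-- (cutfdef), third case: `f(x) = 1 - a(x/M²)` for `M⁻² ≤ x ≤ 1` (indeed for all `x ≥ M⁻²`).
[cite: FeldmanSalmhoferTrubowitz1996, §2 eq. (cutfdef) (arXiv p.14 L48-55)] -/
theorem sliceFn_eq_one_sub_of_le {x : ℝ} (hx : (M ^ 2)⁻¹ ≤ x) :
    χ.sliceFn x = 1 - χ.a (x / M ^ 2) := by
  rw [sliceFn, χ.eq_one x hx]

/-- (cutfdef), fourth case: `f(x) = 0` for `x ≥ 1`.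
[cite: FeldmanSalmhoferTrubowitz1996, §2 eq. (cutfdef) (arXiv p.14 L48-55)] -/
theorem sliceFn_eq_zero_of_one_le (hM : 1 < M) {x : ℝ} (hx : 1 ≤ x) : χ.sliceFn x = 0 := by
  have hM2 : 0 < M ^ 2 := by positivity
  have h1 : (M ^ 2)⁻¹ ≤ x := by
    refine le_trans ?_ hx
    rw [inv_le_one_iff₀]
    exact Or.inr (by nlinarith)
  have h2 : (M ^ 2)⁻¹ ≤ x / M ^ 2 := by
    rw [le_div_iff₀ hM2, inv_mul_cancel₀ hM2.ne']
    exact hx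
  rw [χ.sliceFn_eq_one_sub_of_le h1, χ.eq_one _ h2, sub_self]

/-- **`f ≥ 0`** ("so that, for all `x > 0`, `f(x) ≥ 0`", [I] p.14 L57; here for all `x`, `a` being
extended by zero). [cite: FeldmanSalmhoferTrubowitz1996, §2 eq. (cutfdef) (arXiv p.14 L48-57)] -/
theorem sliceFn_nonneg (hM : 1 < M) (x : ℝ) : 0 ≤ χ.sliceFn x := by
  rw [sliceFn, sub_nonneg]
  rcases le_or_gt 0 x with h0 | h0
  · exact χ.monotone (div_le_self h0 (by nlinarith))
  · rw [χ.a_eq_zero_of_nonpos h0.le, χ.a_eq_zero_of_nonpos]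
    exact (div_neg_of_neg_of_pos h0 (by positivity)).le

/-- `f ≤ 1`. [cite: FeldmanSalmhoferTrubowitz1996, §2 eq. (cutfdef) (arXiv p.14 L48-55)] -/
theorem sliceFn_le_one (x : ℝ) : χ.sliceFn x ≤ 1 := by
  rw [sliceFn]
  linarith [χ.a_le_one x, χ.a_nonneg (x / M ^ 2)]

/-- The support of the slice function: `f(x) ≠ 0 ⇒ M⁻⁴ < x < 1` ("`supp f_j = [M^{2j-4}, M^{2j}]`",
[I] p.14 L63–66, at `j = 0`). [cite: FeldmanSalmhoferTrubowitz1996, §2 (arXiv p.14 L63-66)] -/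
theorem lt_and_lt_of_sliceFn_ne_zero (hM : 1 < M) {x : ℝ} (hx : χ.sliceFn x ≠ 0) :
    (M ^ 4)⁻¹ < x ∧ x < 1 := by
  by_contra h
  rw [not_and_or, not_lt, not_lt] at h
  rcases h with h | h
  · exact hx (χ.sliceFn_eq_zero_of_le hM h)
  · exact hx (χ.sliceFn_eq_zero_of_one_le hM h)

/-! ### (prtunity): `1 - a(x) = Σ_{j<0} f(M^{-2j} x)` [II p.11 L4; I p.14 L59-61] -/

/-- The telescope behind (prtunity): `Σ_{n<N} f(M^{2(n+1)} x) = a(M^{2N} x) - a(x)`.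
[cite: FeldmanSalmhoferTrubowitz1996, §2 eq. (prtunity) (arXiv p.14 L59-61)] -/
theorem sum_range_sliceFn (x : ℝ) (N : ℕ) :
    ∑ n ∈ Finset.range N, χ.sliceFn (M ^ (2 * (n + 1)) * x) = χ.a (M ^ (2 * N) * x) - χ.a x := by
  have hterm : ∀ n : ℕ, χ.sliceFn (M ^ (2 * (n + 1)) * x) =
      χ.a (M ^ (2 * (n + 1)) * x) - χ.a (M ^ (2 * n) * x) := by
    intro n
    have hM : M ≠ 0 := by
      intro h0
      have h1 := χ.one_lt_sq
      rw [h0] at h1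
      norm_num at h1
    rw [sliceFn]
    congr 2
    field_simp
    ring
  simp_rw [hterm]
  rw [Finset.sum_range_sub (fun n => χ.a (M ^ (2 * n) * x)) N]
  simp

/-- **(prtunity)** "`1 - a(x) = Σ_{j=-∞}^{-1} f(M^{-2j} x)` for all `x > 0`" ([I] p.14 L59–61; [II]
p.11 L4), with the scale index `j = -(n+1)`, `n ∈ ℕ`: `Σ_{n≥0} f(M^{2(n+1)} x) = 1 - a(x)`. The
series is a finite sum (its terms vanish once `M^{2(n+1)} x ≥ 1`).
[cite: FeldmanSalmhoferTrubowitz1996, §2 eq. (prtunity) (arXiv p.14 L59-61)] -/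
theorem hasSum_sliceFn (hM : 1 < M) {x : ℝ} (hx : 0 < x) :
    HasSum (fun n : ℕ => χ.sliceFn (M ^ (2 * (n + 1)) * x)) (1 - χ.a x) := by
  have hM2 : 1 < M ^ 2 := by nlinarith
  obtain ⟨N, hN⟩ := pow_unbounded_of_one_lt x⁻¹ hM2
  have hNx : 1 ≤ M ^ (2 * N) * x := by
    rw [pow_mul]
    have := (inv_lt_iff_one_lt_mul₀ hx).1 hN
    linarith
  have hzero : ∀ n ∉ Finset.range N, χ.sliceFn (M ^ (2 * (n + 1)) * x) = 0 := by
    intro n hn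
    rw [Finset.mem_range, not_lt] at hn
    refine χ.sliceFn_eq_zero_of_one_le hM (hNx.trans ?_)
    refine mul_le_mul_of_nonneg_right (pow_le_pow_right₀ hM.le (by omega)) hx.le
  have h : HasSum (fun n : ℕ => χ.sliceFn (M ^ (2 * (n + 1)) * x))
      (∑ n ∈ Finset.range N, χ.sliceFn (M ^ (2 * (n + 1)) * x)) := hasSum_sum_of_ne_finset_zero hzero
  rwa [χ.sum_range_sliceFn x N, χ.eq_one _ (le_trans (inv_le_one_of_one_le₀ hM2.le) hNx)] at h

/-! ### (CpzE): `C_{<0} = Σ_{j<0} C_j` [II p.11 L8-12] -/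

/-- The slice of index `j = -(n+1)`: `C_{-(n+1)}(p₀,E) = f(M^{2(n+1)}(p₀²+E²)) C(p₀,E)`.
[cite: FeldmanSalmhoferTrubowitz1998, §2.5 eq. (CpzE) (arXiv p.11 L8-12)] -/
theorem covSlice_neg_succ (n : ℕ) (ω E : ℝ) :
    χ.covSlice (-(n + 1 : ℤ)) ω E =
      (χ.sliceFn (M ^ (2 * (n + 1)) * (ω ^ 2 + E ^ 2)) : ℂ) * freePropagator ω E := by
  have h : M ^ (-2 * -(n + 1 : ℤ)) = M ^ (2 * (n + 1)) := by
    rw [show (-2 : ℤ) * -(n + 1 : ℤ) = ((2 * (n + 1) : ℕ) : ℤ) by push_cast; ring, zpow_natCast]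
  rw [covSlice, h]

/-- **(CpzE)** "`C_{<0}(p₀, E) = (1 - a(p₀²+E²))/(ip₀ - E) = Σ_{j<0} C_j(p₀, E)`" ([II] p.11 L8–12),
with `j = -(n+1)`: `Σ_{n≥0} C_{-(n+1)}(p₀,E) = C_{<0}(p₀,E)` for all `(p₀, E)` (at the origin both
sides are `0` by the junk value of `C`). [cite: FeldmanSalmhoferTrubowitz1998, §2.5 eq. (CpzE) (arXiv p.11 L8-12)] -/
theorem hasSum_covSlice (hM : 1 < M) (ω E : ℝ) :
    HasSum (fun n : ℕ => χ.covSlice (-(n + 1 : ℤ)) ω E) (χ.covIR ω E) := by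
  simp_rw [χ.covSlice_neg_succ]
  rcases (add_nonneg (sq_nonneg ω) (sq_nonneg E)).eq_or_lt with h0 | hpos
  · -- the origin: every term and the sum vanish through `C(0, 0) = 0`
    have hω : ω = 0 := by nlinarith [sq_nonneg ω, sq_nonneg E]
    have hE : E = 0 := by nlinarith [sq_nonneg ω, sq_nonneg E]
    subst hω; subst hE
    have hC : freePropagator 0 0 = 0 := by simp [freePropagator]
    simp only [hC, mul_zero, covIR]
    exact hasSum_zero
  · rw [covIR]
    exact (Complex.hasSum_ofReal.2 (χ.hasSum_sliceFn hM hpos)).mul_right _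

/-! ### The support of `C_j` and (shellj) at `s = 0` [II p.11 L16-29; I Lemma 2.3 (i) p.14 L97-104] -/

/-- `|C(p₀, E)| = 1/|ip₀ - E| = (p₀² + E²)^{-1/2}` (junk `0` at the origin).
[cite: FeldmanSalmhoferTrubowitz1998, §2.3 (arXiv p.10 L1-8)] -/
theorem _root_.Literature.MathematicalPhysics.QuantumLattice.FermiRG.norm_freePropagator (ω E : ℝ) :
    ‖freePropagator ω E‖ = (Real.sqrt (ω ^ 2 + E ^ 2))⁻¹ := by
  rw [freePropagator, norm_div, norm_one, one_div]
  congr 1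
  rw [Complex.norm_def, Complex.normSq_apply]
  congr 1
  simp
  ring

/-- **The support of the slice propagator**: `C_j(p₀, E) ≠ 0 ⇒ M^{2j-4} < p₀² + E² < M^{2j}`, i.e.
`|ip₀ - E| ∈ (M^{j-2}, M^j)` ("the support of `C_j` is contained in the product of an interval of length
`2M^j` in `p₀` and a thin shell of thickness `M^j` around the Fermi surface", [II] p.11 L28–29; [I]
Lemma 2.3 (i) `𝟙(|ip₀ + e(p)| ∈ [M^{j-2}, M^j])`, p.14 L97–104).
[cite: FeldmanSalmhoferTrubowitz1998, §2.5 (arXiv p.11 L28-29)] -/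
theorem sq_lt_of_covSlice_ne_zero (hM : 1 < M) {j : ℤ} {ω E : ℝ} (h : χ.covSlice j ω E ≠ 0) :
    M ^ (2 * j - 4) < ω ^ 2 + E ^ 2 ∧ ω ^ 2 + E ^ 2 < M ^ (2 * j) := by
  have hM0 : 0 < M := lt_trans zero_lt_one hM
  have hf : χ.sliceFn (M ^ (-2 * j) * (ω ^ 2 + E ^ 2)) ≠ 0 := by
    intro h0
    apply h
    rw [covSlice, h0, Complex.ofReal_zero, zero_mul]
  obtain ⟨h1, h2⟩ := χ.lt_and_lt_of_sliceFn_ne_zero hM hf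
  have hpow : 0 < M ^ (2 * j) := zpow_pos hM0 _
  have hinv : M ^ (-2 * j) = (M ^ (2 * j))⁻¹ := by
    rw [show (-2 : ℤ) * j = -(2 * j) by ring, zpow_neg]
  rw [hinv] at h1 h2
  constructor
  · have h3 : M ^ (2 * j) * (M ^ 4)⁻¹ < ω ^ 2 + E ^ 2 := (lt_inv_mul_iff₀ hpow).1 h1
    have h4 : M ^ (2 * j - 4) = M ^ (2 * j) * (M ^ 4)⁻¹ := by
      rw [zpow_sub₀ hM0.ne', zpow_ofNat, div_eq_mul_inv]
    rwa [h4]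
  · have h3 := (inv_mul_lt_iff₀ hpow).1 h2
    simpa using h3

/-- The support of `f_j(x) = f(M^{-2j} x)`: "`supp f_j = [M^{2j-4}, M^{2j}]`" ([I] p.14 L63–67), as
`f(M^{-2j} x) ≠ 0 ⇒ M^{2j-4} < x < M^{2j}`. [cite: FeldmanSalmhoferTrubowitz1996, §2 (arXiv p.14 L63-67)] -/
theorem lt_and_lt_of_sliceFn_mul_ne_zero (hM : 1 < M) {j : ℤ} {x : ℝ}
    (h : χ.sliceFn (M ^ (-2 * j) * x) ≠ 0) : M ^ (2 * j - 4) < x ∧ x < M ^ (2 * j) := by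
  have hM0 : 0 < M := lt_trans zero_lt_one hM
  obtain ⟨h1, h2⟩ := χ.lt_and_lt_of_sliceFn_ne_zero hM h
  have hpow : 0 < M ^ (2 * j) := zpow_pos hM0 _
  have hinv : M ^ (-2 * j) = (M ^ (2 * j))⁻¹ := by
    rw [show (-2 : ℤ) * j = -(2 * j) by ring, zpow_neg]
  rw [hinv] at h1 h2
  constructor
  · have h3 : M ^ (2 * j) * (M ^ 4)⁻¹ < x := (lt_inv_mul_iff₀ hpow).1 h1
    have h4 : M ^ (2 * j - 4) = M ^ (2 * j) * (M ^ 4)⁻¹ := by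
      rw [zpow_sub₀ hM0.ne', zpow_ofNat, div_eq_mul_inv]
    rwa [h4]
  · have h3 := (inv_mul_lt_iff₀ hpow).1 h2
    simpa using h3

/-- **(Nullzwei)** "for all `x ≥ 0`, `f_j(x) f_{j'}(x) = 0` if `|j - j'| ≥ 2`" ([I] p.14 L69–73; here for
every real `x`, `a` being extended below `M⁻⁴` by zero): slices two or more scales apart have disjoint
supports. [cite: FeldmanSalmhoferTrubowitz1996, §2 eq. (Nullzwei) (arXiv p.14 L69-73)] -/
theorem sliceFn_mul_sliceFn_eq_zero (hM : 1 < M) {j j' : ℤ} (hjj' : 2 ≤ |j - j'|) (x : ℝ) :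
    χ.sliceFn (M ^ (-2 * j) * x) * χ.sliceFn (M ^ (-2 * j') * x) = 0 := by
  wlog hle : j' + 2 ≤ j generalizing j j'
  · have h' : j + 2 ≤ j' := by
      rcases le_abs.1 hjj' with h1 | h1 <;> omega
    rw [mul_comm]
    exact this (by rwa [abs_sub_comm]) h'
  by_contra hne
  obtain ⟨h1, h2⟩ := mul_ne_zero_iff.1 hne
  obtain ⟨hx1, -⟩ := χ.lt_and_lt_of_sliceFn_mul_ne_zero hM h1
  obtain ⟨-, hx2⟩ := χ.lt_and_lt_of_sliceFn_mul_ne_zero hM h2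
  have hmono : M ^ (2 * j') ≤ M ^ (2 * j - 4) := zpow_le_zpow_right₀ hM.le (by omega)
  linarith

/-- (Nullzwei) for the slice covariances: `C_j(p₀, E) C_{j'}(p₀, E) = 0` if `|j - j'| ≥ 2`, for all
`(p₀, E)`. [cite: FeldmanSalmhoferTrubowitz1996, §2 eq. (Nullzwei) (arXiv p.14 L69-73)] -/
theorem covSlice_mul_covSlice_eq_zero (hM : 1 < M) {j j' : ℤ} (hjj' : 2 ≤ |j - j'|) (ω E : ℝ) :
    χ.covSlice j ω E * χ.covSlice j' ω E = 0 := by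
  wlog hle : j' + 2 ≤ j generalizing j j'
  · have h' : j + 2 ≤ j' := by
      rcases le_abs.1 hjj' with h1 | h1 <;> omega
    rw [mul_comm]
    exact this (by rwa [abs_sub_comm]) h'
  by_contra hne
  obtain ⟨h1, h2⟩ := mul_ne_zero_iff.1 hne
  obtain ⟨hx1, -⟩ := χ.sq_lt_of_covSlice_ne_zero hM h1
  obtain ⟨-, hx2⟩ := χ.sq_lt_of_covSlice_ne_zero hM h2
  have hmono : M ^ (2 * j') ≤ M ^ (2 * j - 4) := zpow_le_zpow_right₀ hM.le (by omega)
  linarith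

/-- **(shellj) at `s = 0`, with the printed constant `W₀ = M²`**: "on 'slice' number `j`, the propagator
is for all `(p₀, p)` of absolute value at most `M^{2-j}` (`s = 0` in (shellj); `W₀ = M²`)" ([II]
p.11 L16–27; [I] Lemma 2.3 (i) "`|C_j(p₀, e(p))| ≤ M^{-j+2} 𝟙(…)`", p.14 L97–104):
`|C_j(p₀, E)| ≤ M² M^{-j} 𝟙(p₀² + E² ≤ M^{2j})` for every `j ∈ ℤ` and all `(p₀, E)`; with `E = e(p)`
this is (shellj) for `s = 0`. [cite: FeldmanSalmhoferTrubowitz1998, §2.5 eq. (shellj), s = 0 (arXiv p.11 L16-27)] -/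
theorem norm_covSlice_le (hM : 1 < M) (j : ℤ) (ω E : ℝ) :
    ‖χ.covSlice j ω E‖ ≤ M ^ 2 * M ^ (-j) * scaleInd M j ω E := by
  have hM0 : 0 < M := lt_trans zero_lt_one hM
  by_cases h : χ.covSlice j ω E = 0
  · rw [h, norm_zero]
    exact mul_nonneg (mul_nonneg (sq_nonneg M) (zpow_pos hM0 _).le) (scaleInd_mem_Icc M j ω E).1
  obtain ⟨hlo, hhi⟩ := χ.sq_lt_of_covSlice_ne_zero hM h
  have hind : scaleInd M j ω E = 1 := by rw [scaleInd, if_pos hhi.le]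
  rw [hind, mul_one, covSlice, norm_mul, Complex.norm_real, Real.norm_of_nonneg (χ.sliceFn_nonneg hM _),
    norm_freePropagator]
  have hsq : (M ^ (j - 2)) ^ 2 = M ^ (2 * j - 4) := by
    rw [← zpow_natCast, ← zpow_mul]
    congr 1
    push_cast
    ring
  have hsqrt : M ^ (j - 2) < Real.sqrt (ω ^ 2 + E ^ 2) := by
    rw [Real.lt_sqrt (zpow_pos hM0 _).le, hsq]
    exact hlo
  have hinv : (M ^ (j - 2))⁻¹ = M ^ 2 * M ^ (-j) := by
    rw [← zpow_neg, show -(j - 2) = 2 + -j by ring, zpow_add₀ hM0.ne', zpow_ofNat]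
  calc χ.sliceFn (M ^ (-2 * j) * (ω ^ 2 + E ^ 2)) * (Real.sqrt (ω ^ 2 + E ^ 2))⁻¹
      ≤ 1 * (Real.sqrt (ω ^ 2 + E ^ 2))⁻¹ :=
        mul_le_mul_of_nonneg_right (χ.sliceFn_le_one _) (inv_nonneg.2 (Real.sqrt_nonneg _))
    _ ≤ M ^ 2 * M ^ (-j) := by
        rw [one_mul, ← hinv]
        exact inv_anti₀ (zpow_pos hM0 _) hsqrt.le

/-- (shellj) at `s = 0` in the real-power form of the scale hypotheses (onlyyou) of Theorem 3.5
(`FST2SecondOrderStrings.StringsTheorem`, string `S(p₀, p) = C_j(p₀, e(p))` with `ν = 1`, `|α| = 0`):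
`|C_j(p₀, E)| ≤ M² · M^{-(j:ℝ)} · 𝟙(|ip₀ - E| ≤ M^j)`.
[cite: FeldmanSalmhoferTrubowitz1998, §2.5 eq. (shellj), s = 0 (arXiv p.11 L16-27)] -/
theorem norm_covSlice_le_rpow (hM : 1 < M) (j : ℤ) (ω E : ℝ) :
    ‖χ.covSlice j ω E‖ ≤ M ^ 2 * M ^ (-(j : ℝ)) * scaleInd M j ω E := by
  have h := χ.norm_covSlice_le hM j ω E
  have hcast : M ^ (-(j : ℝ)) = M ^ (-j) := by
    rw [show (-(j : ℝ)) = ((-j : ℤ) : ℝ) by push_cast; ring, Real.rpow_intCast]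
  rwa [hcast]

/-! ### (shellj) for all orders `s`: derivatives of the slice propagator [II p.11 L16-27; I Lemma 2.3 (iii)] -/

/-- The free propagator is homogeneous of degree `-1`: `C(λp₀, λE) = λ⁻¹ C(p₀, E)`.
[cite: FeldmanSalmhoferTrubowitz1998, §2.3 (arXiv p.10 L1-8)] -/
theorem _root_.Literature.MathematicalPhysics.QuantumLattice.FermiRG.freePropagator_smul
    {c : ℝ} (hc : c ≠ 0) (ω E : ℝ) :
    freePropagator (c * ω) (c * E) = ((c⁻¹ : ℝ) : ℂ) * freePropagator ω E := by
  simp only [freePropagator, Complex.ofReal_mul, Complex.ofReal_inv]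
  have hc' : (c : ℂ) ≠ 0 := by exact_mod_cast hc
  rw [show Complex.I * (↑c * ↑ω) - ↑c * ↑E = (c : ℂ) * (Complex.I * ↑ω - ↑E) by ring]
  rw [one_div, one_div, mul_inv]

/-- **Scaling**: `C_j(p₀, E) = M^{-j} C_0(M^{-j}p₀, M^{-j}E)` — slice `j` is the rescaling by `M^{-j}`
of slice `0` ([II] (CpzE): `C_j(p₀,E) = f(M^{-2j}(p₀²+E²))/(ip₀ - E)`).
[cite: FeldmanSalmhoferTrubowitz1998, §2.5 eq. (CpzE) (arXiv p.11 L8-12)] -/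
theorem covSlice_eq_smul_covSlice_zero (hM : 1 < M) (j : ℤ) (q : ℝ × ℝ) :
    χ.covSlice j q.1 q.2 =
      (M ^ (-j) : ℝ) • χ.covSlice 0 ((M ^ (-j) • ContinuousLinearMap.id ℝ (ℝ × ℝ)) q).1
        ((M ^ (-j) • ContinuousLinearMap.id ℝ (ℝ × ℝ)) q).2 := by
  have hM0 : 0 < M := lt_trans zero_lt_one hM
  have hc : M ^ (-j) ≠ 0 := (zpow_pos hM0 _).ne'
  simp only [_root_.smul_apply, ContinuousLinearMap.coe_id', id_eq,
    Prod.smul_fst, Prod.smul_snd, smul_eq_mul, covSlice]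
  rw [freePropagator_smul hc, Complex.real_smul]
  have h1 : M ^ (-2 * (0 : ℤ)) * ((M ^ (-j) * q.1) ^ 2 + (M ^ (-j) * q.2) ^ 2) =
      M ^ (-2 * j) * (q.1 ^ 2 + q.2 ^ 2) := by
    rw [mul_zero, zpow_zero, one_mul, show (-2 : ℤ) * j = -j * 2 by ring, zpow_mul, zpow_ofNat]
    ring
  rw [h1]
  have h2 : ((M ^ (-j) : ℝ) : ℂ) * ((((M ^ (-j))⁻¹ : ℝ) : ℂ)) = 1 := by
    rw [← Complex.ofReal_mul, mul_inv_cancel₀ hc, Complex.ofReal_one]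
  calc (χ.sliceFn (M ^ (-2 * j) * (q.1 ^ 2 + q.2 ^ 2)) : ℂ) * freePropagator q.1 q.2
      = (((M ^ (-j) : ℝ) : ℂ) * (((M ^ (-j))⁻¹ : ℝ) : ℂ)) *
          ((χ.sliceFn (M ^ (-2 * j) * (q.1 ^ 2 + q.2 ^ 2)) : ℂ) * freePropagator q.1 q.2) := by
        rw [h2, one_mul]
    _ = _ := by ring

/-- The slice propagators are smooth on all of `ℝ × ℝ` (`f ∘ r²` vanishes near the singularity of `C`
at the origin). [cite: FeldmanSalmhoferTrubowitz1998, §2.5 (arXiv p.11 L13-16)] -/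
theorem contDiff_covSlice_zero (hM : 1 < M) :
    ContDiff ℝ (⊤ : ℕ∞) (fun q : ℝ × ℝ => χ.covSlice 0 q.1 q.2) := by
  have hM0 : 0 < M := lt_trans zero_lt_one hM
  have hslice : ContDiff ℝ (⊤ : ℕ∞) χ.sliceFn := by
    have h : χ.sliceFn = fun x => χ.a x - χ.a (x / M ^ 2) := funext fun x => rfl
    rw [h]
    exact χ.contDiff.sub (χ.contDiff.comp (contDiff_id.div_const _))
  have hr : ContDiff ℝ (⊤ : ℕ∞) (fun q : ℝ × ℝ => M ^ (-2 * (0 : ℤ)) * (q.1 ^ 2 + q.2 ^ 2)) :=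
    contDiff_const.mul ((contDiff_fst.pow 2).add (contDiff_snd.pow 2))
  have hnum : ContDiff ℝ (⊤ : ℕ∞)
      (fun q : ℝ × ℝ => ((χ.sliceFn (M ^ (-2 * (0 : ℤ)) * (q.1 ^ 2 + q.2 ^ 2)) : ℝ) : ℂ)) :=
    Complex.ofRealCLM.contDiff.comp (hslice.comp hr)
  have hden : ContDiff ℝ (⊤ : ℕ∞) (fun q : ℝ × ℝ => Complex.I * (q.1 : ℂ) - (q.2 : ℂ)) :=
    (contDiff_const.mul (Complex.ofRealCLM.contDiff.comp contDiff_fst)).sub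
      (Complex.ofRealCLM.contDiff.comp contDiff_snd)
  rw [contDiff_iff_contDiffAt]
  intro q
  by_cases hq : q = 0
  · -- near the origin the slice vanishes identically
    subst hq
    have hev : (fun q : ℝ × ℝ => χ.covSlice 0 q.1 q.2) =ᶠ[𝓝 (0 : ℝ × ℝ)] fun _ => 0 := by
      have hopen : IsOpen {q : ℝ × ℝ | q.1 ^ 2 + q.2 ^ 2 < (M ^ 4)⁻¹} :=
        isOpen_lt ((continuous_fst.pow 2).add (continuous_snd.pow 2)) continuous_const
      have hmem : (0 : ℝ × ℝ) ∈ {q : ℝ × ℝ | q.1 ^ 2 + q.2 ^ 2 < (M ^ 4)⁻¹} := by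
        simp only [mem_setOf_eq, Prod.fst_zero, Prod.snd_zero]
        norm_num
        positivity
      filter_upwards [hopen.mem_nhds hmem] with q hq
      rw [covSlice, χ.sliceFn_eq_zero_of_le hM, Complex.ofReal_zero, zero_mul]
      rw [mul_zero, zpow_zero, one_mul]
      exact hq.le
    exact contDiffAt_const.congr_of_eventuallyEq hev
  · have hne : Complex.I * (q.1 : ℂ) - (q.2 : ℂ) ≠ 0 := by
      intro h0
      apply hq
      have h1 := congrArg Complex.re h0
      have h2 := congrArg Complex.im h0
      simp at h1 h2
      ext <;> simp [h1, h2]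
    have hinv : ContDiffAt ℝ (⊤ : ℕ∞) (fun q : ℝ × ℝ => (Complex.I * (q.1 : ℂ) - (q.2 : ℂ))⁻¹) q :=
      hden.contDiffAt.inv hne
    have hC : (fun q : ℝ × ℝ => χ.covSlice 0 q.1 q.2) = fun q : ℝ × ℝ =>
        ((χ.sliceFn (M ^ (-2 * (0 : ℤ)) * (q.1 ^ 2 + q.2 ^ 2)) : ℝ) : ℂ) *
          (Complex.I * (q.1 : ℂ) - (q.2 : ℂ))⁻¹ := by
      funext q
      rw [covSlice, freePropagator, one_div]
    rw [hC]
    exact hnum.contDiffAt.mul hinv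

/-- The slice-`0` propagator has compact support: `supp C_0 ⊆ {p₀² + E² ≤ 1}`.
[cite: FeldmanSalmhoferTrubowitz1996, §2 (arXiv p.14 L63-66)] -/
theorem hasCompactSupport_covSlice_zero (hM : 1 < M) :
    HasCompactSupport (fun q : ℝ × ℝ => χ.covSlice 0 q.1 q.2) := by
  refine HasCompactSupport.intro (isCompact_closedBall (0 : ℝ × ℝ) 1) fun q hq => ?_
  by_contra hne
  apply hq
  obtain ⟨-, hhi⟩ := χ.sq_lt_of_covSlice_ne_zero hM hne
  rw [mul_zero, zpow_zero] at hhi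
  have h1 : q.1 ^ 2 ≤ 1 := by nlinarith [sq_nonneg q.2]
  have h2 : q.2 ^ 2 ≤ 1 := by nlinarith [sq_nonneg q.1]
  rw [Metric.mem_closedBall, dist_zero_right, Prod.norm_def, Real.norm_eq_abs, Real.norm_eq_abs]
  exact max_le ((sq_le_one_iff_abs_le_one _).1 h1) ((sq_le_one_iff_abs_le_one _).1 h2)

/-- All slice propagators are smooth on `ℝ × ℝ` (rescalings of slice `0`).
[cite: FeldmanSalmhoferTrubowitz1998, §2.5 (arXiv p.11 L13-16)] -/
theorem contDiff_covSlice (hM : 1 < M) (j : ℤ) :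
    ContDiff ℝ (⊤ : ℕ∞) (fun q : ℝ × ℝ => χ.covSlice j q.1 q.2) := by
  have h : (fun q : ℝ × ℝ => χ.covSlice j q.1 q.2) = fun q : ℝ × ℝ => (M ^ (-j) : ℝ) •
      ((fun q : ℝ × ℝ => χ.covSlice 0 q.1 q.2) ∘ (M ^ (-j) • ContinuousLinearMap.id ℝ (ℝ × ℝ))) q :=
    funext fun q => χ.covSlice_eq_smul_covSlice_zero hM j q
  rw [h]
  have hL : ContDiff ℝ (⊤ : ℕ∞) (fun q : ℝ × ℝ => (M ^ (-j) • ContinuousLinearMap.id ℝ (ℝ × ℝ)) q) :=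
    (M ^ (-j) • ContinuousLinearMap.id ℝ (ℝ × ℝ)).contDiff
  exact ((χ.contDiff_covSlice_zero hM).comp hL).const_smul (M ^ (-j) : ℝ)

/-- The closed support of `C_j` lies in the shell `{p₀² + E² ≤ M^{2j}}` (so the same holds for all its
derivatives). [cite: FeldmanSalmhoferTrubowitz1998, §2.5 (arXiv p.11 L28-29)] -/
theorem tsupport_covSlice_subset (hM : 1 < M) (j : ℤ) :
    tsupport (fun q : ℝ × ℝ => χ.covSlice j q.1 q.2) ⊆ {q : ℝ × ℝ | q.1 ^ 2 + q.2 ^ 2 ≤ M ^ (2 * j)} := by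
  refine closure_minimal (fun q hq => ?_)
    (isClosed_le ((continuous_fst.pow 2).add (continuous_snd.pow 2)) continuous_const)
  exact (χ.sq_lt_of_covSlice_ne_zero hM hq).2.le

/-- **(shellj), all orders, in the variables `(p₀, E)`**: there are constants `W_s` (depending on `M`
and the cutoff `a` only) with `‖D^s C_j(p₀, E)‖ ≤ W_s M^{-(s+1)j} 𝟙(p₀² + E² ≤ M^{2j})` for all
`s ∈ ℕ`, `j ∈ ℤ` and `(p₀, E) ∈ ℝ²` ("every derivative produces another large factor `M^{-j}`", [II]
p.11 L25–27). Proof: `C_j = M^{-j} C_0 ∘ (M^{-j}·)` and `C_0` is smooth with compact support, so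
`W_s = sup ‖D^s C_0‖`. [cite: FeldmanSalmhoferTrubowitz1998, §2.5 eq. (shellj) (arXiv p.11 L16-27)] -/
theorem exists_norm_iteratedFDeriv_covSlice_le (hM : 1 < M) :
    ∃ W : ℕ → ℝ, (∀ s, 0 ≤ W s) ∧ ∀ (s : ℕ) (j : ℤ) (q : ℝ × ℝ),
      ‖iteratedFDeriv ℝ s (fun q : ℝ × ℝ => χ.covSlice j q.1 q.2) q‖ ≤
        W s * M ^ (-((s + 1 : ℕ) : ℤ) * j) * scaleInd M j q.1 q.2 := by
  have hM0 : 0 < M := lt_trans zero_lt_one hM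
  set C0 : ℝ × ℝ → ℂ := fun q => χ.covSlice 0 q.1 q.2 with hC0
  have hC0smooth : ContDiff ℝ (⊤ : ℕ∞) C0 := χ.contDiff_covSlice_zero hM
  have hC0supp : HasCompactSupport C0 := χ.hasCompactSupport_covSlice_zero hM
  -- `W s = sup ‖D^s C_0‖`
  have hbound : ∀ s : ℕ, ∃ B : ℝ, 0 ≤ B ∧ ∀ q, ‖iteratedFDeriv ℝ s C0 q‖ ≤ B := by
    intro s
    obtain ⟨B, hB⟩ := (hC0smooth.continuous_iteratedFDeriv (m := s) (by exact_mod_cast le_top)).bounded_above_of_compact_support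
      (hC0supp.iteratedFDeriv s)
    exact ⟨max B 0, le_max_right _ _, fun q => (hB q).trans (le_max_left _ _)⟩
  choose W hW0 hW using hbound
  refine ⟨W, hW0, fun s j q => ?_⟩
  set L : ℝ × ℝ →L[ℝ] ℝ × ℝ := (M ^ (-j) : ℝ) • ContinuousLinearMap.id ℝ (ℝ × ℝ) with hL
  have hLnorm : ‖L‖ ≤ M ^ (-j) := by
    rw [hL, norm_smul, Real.norm_of_nonneg (zpow_pos hM0 _).le]
    exact mul_le_of_le_one_right (zpow_pos hM0 _).le ContinuousLinearMap.norm_id_le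
  -- the iterated derivative of the rescaled function
  have hfun : (fun q : ℝ × ℝ => χ.covSlice j q.1 q.2) = fun q => (M ^ (-j) : ℝ) • (C0 ∘ L) q :=
    funext fun q => χ.covSlice_eq_smul_covSlice_zero hM j q
  have hcomp : ContDiff ℝ (⊤ : ℕ∞) (C0 ∘ L) := hC0smooth.comp L.contDiff
  have hD : iteratedFDeriv ℝ s (fun q : ℝ × ℝ => χ.covSlice j q.1 q.2) q =
      (M ^ (-j) : ℝ) • (iteratedFDeriv ℝ s C0 (L q)).compContinuousLinearMap fun _ => L := by
    rw [hfun, iteratedFDeriv_const_smul_apply' (hcomp.contDiffAt.of_le (by exact_mod_cast le_top)),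
      L.iteratedFDeriv_comp_right hC0smooth q (by exact_mod_cast le_top)]
  -- the indicator: derivatives vanish off the closed support
  by_cases hzero : iteratedFDeriv ℝ s (fun q : ℝ × ℝ => χ.covSlice j q.1 q.2) q = 0
  · rw [hzero, norm_zero]
    exact mul_nonneg (mul_nonneg (hW0 s) (zpow_pos hM0 _).le) (scaleInd_mem_Icc M j q.1 q.2).1
  have hmem : q ∈ tsupport (fun q : ℝ × ℝ => χ.covSlice j q.1 q.2) :=
    support_iteratedFDeriv_subset s (Function.mem_support.2 hzero)
  have hq2 : q.1 ^ 2 + q.2 ^ 2 ≤ M ^ (2 * j) := χ.tsupport_covSlice_subset hM j hmem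
  have hind : scaleInd M j q.1 q.2 = 1 := by
    rw [scaleInd, if_pos hq2]
  rw [hind, mul_one, hD, norm_smul, Real.norm_of_nonneg (zpow_pos hM0 _).le]
  have hprod : ‖(iteratedFDeriv ℝ s C0 (L q)).compContinuousLinearMap fun _ => L‖ ≤
      W s * (M ^ (-j)) ^ s := by
    refine (ContinuousMultilinearMap.norm_compContinuousLinearMap_le _ _).trans ?_
    rw [Finset.prod_const, Finset.card_univ, Fintype.card_fin]
    exact mul_le_mul (hW s _) (pow_le_pow_left₀ (norm_nonneg _) hLnorm s) (by positivity) (hW0 s)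
  have hexp : M ^ (-j) * (W s * (M ^ (-j)) ^ s) = W s * M ^ (-((s + 1 : ℕ) : ℤ) * j) := by
    rw [← zpow_natCast, ← zpow_mul, show -((s + 1 : ℕ) : ℤ) * j = -j + -j * (s : ℕ) by push_cast; ring,
      zpow_add₀ hM0.ne']
    ring
  calc M ^ (-j) * ‖(iteratedFDeriv ℝ s C0 (L q)).compContinuousLinearMap fun _ => L‖
      ≤ M ^ (-j) * (W s * (M ^ (-j)) ^ s) := mul_le_mul_of_nonneg_left hprod (zpow_pos hM0 _).le
    _ = W s * M ^ (-((s + 1 : ℕ) : ℤ) * j) := hexp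

end ScaleCutoff

/-! ### (shellj) as printed: derivatives of `C_j(p₀, e(p))` with respect to `p = (p₀, 𝐩)` -/

section Composed

variable {E' : Type*} [NormedAddCommGroup E'] [NormedSpace ℝ E']

/-- The iterated derivatives of a continuous linear map: `‖D^i L‖ ≤ ‖L‖` for `i ≥ 1` (`D¹L = L`,
`D^i L = 0` for `i ≥ 2`). [folklore] -/
private theorem norm_iteratedFDeriv_clm_le {F G : Type*} [NormedAddCommGroup F] [NormedSpace ℝ F]
    [NormedAddCommGroup G] [NormedSpace ℝ G] (L : F →L[ℝ] G) {i : ℕ} (hi : 1 ≤ i) (x : F) :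
    ‖iteratedFDeriv ℝ i (fun y => L y) x‖ ≤ ‖L‖ := by
  have hfd : fderiv ℝ (fun y => L y) = fun _ => L := by
    funext y; exact L.fderiv
  obtain ⟨n, rfl⟩ := Nat.exists_eq_add_of_le hi
  rcases n with _ | n
  · rw [norm_iteratedFDeriv_one, L.fderiv]
  · rw [show 1 + (n + 1) = (n + 1) + 1 by ring, ← norm_iteratedFDeriv_fderiv, hfd,
      iteratedFDeriv_succ_const, Pi.zero_apply, norm_zero]
    exact norm_nonneg _

/-- **(shellj)** "`max_{|α|=s} |D^α C_j(p₀, e(p))| ≤ W_s M^{-(s+1)j} 𝟙(|ip₀ - e(p)| ≤ M^j)`, `D^α` a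
derivative with respect to `p` of order `s ≤ k` … every derivative produces another large factor
`M^{-j}`; the constant `W_s` depends on `|e|_s` and on `g₀`" ([II] p.11 L16–27; [I] Lemma 2.3 (iii),
p.14 L130–137, "`W_s` depending on `|e|_s` and `M`"). Typed with the Fréchet derivative of order `s`
of `p = (p₀, 𝐩) ↦ C_j(p₀, e(𝐩))` on `ℝ × E'` (its norm dominates every partial derivative
`D^α`, `|α| = s`), for a `C^k` band `e` whose derivatives of orders `1, …, k` are bounded by `K`, all
scales `j ≤ 0` and all `s ≤ k`; the constants depend on `M`, the cutoff and `K`. This is hypothesis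
(onlyyou) of Theorem 3.5 (`FST2SecondOrderStrings.StringsTheorem`) with `ν = 1` for the strings
`S(p) = C_j(p₀, e(𝐩))` of Lemma 3.1. [cite: FeldmanSalmhoferTrubowitz1998, §2.5 eq. (shellj) (arXiv p.11 L16-27)] -/
theorem exists_norm_iteratedFDeriv_covSlice_comp_le {M : ℝ} (χ : ScaleCutoff M) (hM : 1 < M)
    {e : E' → ℝ} {k : ℕ} (he : ContDiff ℝ k e) {K : ℝ}
    (hK : ∀ p : E', ∀ i, 1 ≤ i → i ≤ k → ‖iteratedFDeriv ℝ i e p‖ ≤ K) :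
    ∃ W : ℕ → ℝ, (∀ s, 0 ≤ W s) ∧ ∀ s ≤ k, ∀ j ≤ (0 : ℤ), ∀ (p₀ : ℝ) (p : E'),
      ‖iteratedFDeriv ℝ s (fun q : ℝ × E' => χ.covSlice j q.1 (e q.2)) (p₀, p)‖ ≤
        W s * M ^ (-((s + 1 : ℕ) : ℤ) * j) * scaleInd M j p₀ (e p) := by
  have hM0 : 0 < M := lt_trans zero_lt_one hM
  obtain ⟨W, hW0, hW⟩ := χ.exists_norm_iteratedFDeriv_covSlice_le hM
  -- constants: `D = max 1 K` for the inner map, `Wmax s = Σ_{i ≤ s} W i` for the outer one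
  set D : ℝ := max 1 K with hDdef
  have hD1 : 1 ≤ D := le_max_left _ _
  set Wmax : ℕ → ℝ := fun s => ∑ i ∈ Finset.range (s + 1), W i with hWmax
  have hWle : ∀ i s, i ≤ s → W i ≤ Wmax s := fun i s his =>
    Finset.single_le_sum (fun i _ => hW0 i) (Finset.mem_range.2 (Nat.lt_succ_of_le his))
  have hWmax0 : ∀ s, 0 ≤ Wmax s := fun s => Finset.sum_nonneg fun i _ => hW0 i
  refine ⟨fun s => (s.factorial : ℝ) * Wmax s * D ^ s, fun s =>
    mul_nonneg (mul_nonneg (Nat.cast_nonneg _) (hWmax0 s)) (pow_nonneg (le_trans zero_le_one hD1) s), ?_⟩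
  intro s hs j hj p₀ p
  set g : ℝ × ℝ → ℂ := fun q => χ.covSlice j q.1 q.2 with hgdef
  set ι : ℝ × E' → ℝ × ℝ := fun q => (q.1, e q.2) with hιdef
  have hfun : (fun q : ℝ × E' => χ.covSlice j q.1 (e q.2)) = g ∘ ι := rfl
  have hg : ContDiff ℝ k g := (χ.contDiff_covSlice hM j).of_le (by exact_mod_cast le_top)
  have hι : ContDiff ℝ k ι := contDiff_fst.prodMk (he.comp contDiff_snd)
  set x : ℝ × E' := (p₀, p) with hx
  -- the outer bound, uniform over the orders `i ≤ s`
  set C : ℝ := Wmax s * M ^ (-((s + 1 : ℕ) : ℤ) * j) * scaleInd M j p₀ (e p) with hCdef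
  have hC : ∀ i, i ≤ s → ‖iteratedFDeriv ℝ i g (ι x)‖ ≤ C := by
    intro i hi
    refine (hW i j (ι x)).trans ?_
    have hind := (scaleInd_mem_Icc M j p₀ (e p)).1
    have hpow : M ^ (-((i + 1 : ℕ) : ℤ) * j) ≤ M ^ (-((s + 1 : ℕ) : ℤ) * j) := by
      refine zpow_le_zpow_right₀ hM.le ?_
      have : ((i + 1 : ℕ) : ℤ) * (-j) ≤ ((s + 1 : ℕ) : ℤ) * (-j) :=
        mul_le_mul_of_nonneg_right (by exact_mod_cast Nat.succ_le_succ hi) (by linarith)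
      linarith
    calc W i * M ^ (-((i + 1 : ℕ) : ℤ) * j) * scaleInd M j (ι x).1 (ι x).2
        = W i * M ^ (-((i + 1 : ℕ) : ℤ) * j) * scaleInd M j p₀ (e p) := by rfl
      _ ≤ Wmax s * M ^ (-((s + 1 : ℕ) : ℤ) * j) * scaleInd M j p₀ (e p) :=
          mul_le_mul (mul_le_mul (hWle i s hi) hpow (zpow_pos hM0 _).le (hWmax0 s)) le_rfl hind
            (mul_nonneg (hWmax0 s) (zpow_pos hM0 _).le)
  -- the inner bound `‖D^i ι‖ ≤ D ≤ D^i`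
  have hDi : ∀ i, 1 ≤ i → i ≤ s → ‖iteratedFDeriv ℝ i ι x‖ ≤ D ^ i := by
    intro i hi1 his
    have hik : (i : WithTop ℕ∞) ≤ k := by exact_mod_cast his.trans hs
    have he2 : ContDiff ℝ k (fun q : ℝ × E' => e q.2) := he.comp contDiff_snd
    have hprod : iteratedFDeriv ℝ i ι x = (iteratedFDeriv ℝ i (fun q : ℝ × E' => q.1) x).prod
        (iteratedFDeriv ℝ i (fun q : ℝ × E' => e q.2) x) :=
      iteratedFDeriv_prodMk (f := fun q : ℝ × E' => q.1) (g := fun q : ℝ × E' => e q.2)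
        contDiff_fst.contDiffAt he2.contDiffAt hik
    rw [hprod, ContinuousMultilinearMap.opNorm_prod]
    have hle : D ≤ D ^ i := le_self_pow₀ hD1 (by omega)
    refine max_le ?_ ?_
    · -- the projection `fst` is linear
      have h1 : ‖iteratedFDeriv ℝ i (fun q : ℝ × E' => q.1) x‖ ≤ ‖ContinuousLinearMap.fst ℝ ℝ E'‖ :=
        norm_iteratedFDeriv_clm_le (ContinuousLinearMap.fst ℝ ℝ E') hi1 x
      have h2 : ‖ContinuousLinearMap.fst ℝ ℝ E'‖ ≤ 1 := ContinuousLinearMap.norm_fst_le ..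
      exact (h1.trans (h2.trans hD1)).trans hle
    · -- `e ∘ snd`
      have h1 : iteratedFDeriv ℝ i (fun q : ℝ × E' => e q.2) x =
          (iteratedFDeriv ℝ i e x.2).compContinuousLinearMap fun _ => ContinuousLinearMap.snd ℝ ℝ E' :=
        (ContinuousLinearMap.snd ℝ ℝ E').iteratedFDeriv_comp_right he x hik
      rw [h1]
      refine (ContinuousMultilinearMap.norm_compContinuousLinearMap_le _ _).trans ?_
      have h3 : ∏ _l : Fin i, ‖ContinuousLinearMap.snd ℝ ℝ E'‖ ≤ 1 := by
        refine Finset.prod_le_one (fun _ _ => norm_nonneg _) fun _ _ => ContinuousLinearMap.norm_snd_le ..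
      calc ‖iteratedFDeriv ℝ i e x.2‖ * ∏ _l : Fin i, ‖ContinuousLinearMap.snd ℝ ℝ E'‖
          ≤ K * 1 := mul_le_mul (hK x.2 i hi1 (his.trans hs)) h3
            (Finset.prod_nonneg fun _ _ => norm_nonneg _) ((norm_nonneg _).trans (hK x.2 i hi1 (his.trans hs)))
        _ ≤ D ^ i := by rw [mul_one]; exact (le_max_right _ _).trans hle
  have h := norm_iteratedFDeriv_comp_le hg hι (by exact_mod_cast hs) x hC hDi
  rw [hfun]
  calc ‖iteratedFDeriv ℝ s (g ∘ ι) x‖ ≤ (s.factorial : ℝ) * C * D ^ s := h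
    _ = (s.factorial : ℝ) * Wmax s * D ^ s * M ^ (-((s + 1 : ℕ) : ℤ) * j) * scaleInd M j p₀ (e p) := by
        rw [hCdef]; ring

end Composed

/-! ### The strings of Lemma 3.1 satisfy the string hypotheses of Theorem 3.5 [II p.21 L14-28] -/

section Strings

open Literature.Analysis.FunctionSpaces (eSupNorm_lt_top_iff)

variable {E : Type*} [NormedAddCommGroup E] [InnerProductSpace ℝ E] [CompleteSpace E]

/-- Under (A2)_{k,h} the derivatives of the band of orders `1, …, k` are uniformly bounded
(`e ∈ C^{k,h}(𝓑, ℝ)`: "with bounded derivatives", [II] p.6 L88–104).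
[cite: FeldmanSalmhoferTrubowitz1998, Assumption A2 (arXiv p.7 L53-54)] -/
theorem HypA2.exists_norm_iteratedFDeriv_le {cr : Crystal E} {k : ℕ} {h : ℝ≥0} {e : E → ℝ}
    (hA2 : HypA2 cr k h e) : ∃ K : ℝ, ∀ p : E, ∀ i, 1 ≤ i → i ≤ k → ‖iteratedFDeriv ℝ i e p‖ ≤ K := by
  have hb : ∀ i : ℕ, ∃ C : ℝ, i ≤ k → ∀ p : E, ‖iteratedFDeriv ℝ i e p‖ ≤ C := by
    intro i
    by_cases hi : i ≤ k
    · obtain ⟨C, hC⟩ := eSupNorm_lt_top_iff.1 (hA2.memContDiffHolder.2.1 i hi)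
      exact ⟨C, fun _ => hC⟩
    · exact ⟨0, fun h' => absurd h' hi⟩
  choose C hC using hb
  refine ⟨∑ i ∈ Finset.range (k + 1), |C i|, fun p i hi1 hik => ?_⟩
  have h1 : ‖iteratedFDeriv ℝ i e p‖ ≤ |C i| := (hC i hik p).trans (le_abs_self _)
  exact h1.trans (Finset.single_le_sum (fun j _ => abs_nonneg (C j))
    (Finset.mem_range.2 (Nat.lt_succ_of_le hik)))

/-- **The strings of Lemma 3.1 satisfy the hypotheses of Theorem 3.5** ([II] p.21 L14–28: "take
`ν₁ = ν₂ = ν₃ = 1` and `S^{(3)}(p) = C_{j₃}(p₀, e(𝐩))`. Obviously, then, `∂/∂θ S^{(3)}(p₀, 𝐩(ρ,θ)) = 0`,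
so (thunif) holds, and (onlyyou) holds with `Γ_{3,1,s} = W_s`, `W_s` given in (shellj)"). For a band
with (A2)_{k,h}, any coordinate datum `Φ : TubularCoords cr e k r₀` ([II] §2.2) and a cutoff with `M > 1`,
there is ONE increasing family of constants `Γ_s ≥ 0` such that for every scale `j ≤ 0` the string
`S(p₀, 𝐩) = C_j(p₀, e(𝐩))` is `C^{k-1}`, `Γ#`-periodic, obeys (onlyyou) with `ν = 1`:
`‖D^i S(q)‖ ≤ Γ_i M^{-j(1+i)} 𝟙(|iq₀ - e(𝐪)| ≤ M^j)` for `i ≤ k - 1`, and (thunif) with `ν = 1`: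
`‖∂_θ^s S(p₀, 𝐩(ρ,θ))‖ ≤ Γ_s M^{-j} 𝟙(|ip₀ - ρ| ≤ M^j)` for `s ≤ k - 1`, `|ρ| < 2r₀` (indeed the left
side vanishes for `s ≥ 1` since `e(𝐩(ρ,θ)) = ρ`) — the hypothesis shapes of
`FST2SecondOrderStrings.StringsTheorem`. [cite: FeldmanSalmhoferTrubowitz1998, §3.5 proof of Lemma 3.1 (arXiv p.21 L14-28)] -/
theorem covSlice_string_hypotheses (cr : Crystal E) {e : E → ℝ} {k : ℕ} {h : ℝ≥0}
    (hA2 : HypA2 cr k h e) {r₀ : ℝ} (Φ : TubularCoords cr e k r₀) {M : ℝ} (χ : ScaleCutoff M)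
    (hM : 1 < M) :
    ∃ Γ : ℕ → ℝ, Monotone Γ ∧ (∀ s, 0 ≤ Γ s) ∧ ∀ j : ℤ, j ≤ 0 →
      ContDiff ℝ (k - 1 : ℕ) (fun q : ℝ × E => χ.covSlice j q.1 (e q.2)) ∧
      (∀ γ ∈ cr.dualLattice, ∀ (p₀ : ℝ) (q : E),
        χ.covSlice j p₀ (e (q + γ)) = χ.covSlice j p₀ (e q)) ∧
      (∀ i ≤ k - 1, ∀ q : ℝ × E,
        ‖iteratedFDeriv ℝ i (fun q : ℝ × E => χ.covSlice j q.1 (e q.2)) q‖ ≤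
          Γ i * M ^ (-(j : ℝ) * (1 + i)) * scaleInd M j q.1 (e q.2)) ∧
      (∀ s ≤ k - 1, ∀ (p₀ ρ θ : ℝ), |ρ| < 2 * r₀ →
        ‖iteratedDeriv s (fun θ' => χ.covSlice j p₀ (e (Φ.p ρ θ'))) θ‖ ≤
          Γ s * M ^ (-(1 : ℝ) * j) * scaleInd M j p₀ ρ) := by
  have hM0 : 0 < M := lt_trans zero_lt_one hM
  have he : ContDiff ℝ k e := hA2.memContDiffHolder.contDiff
  obtain ⟨K, hK⟩ := hA2.exists_norm_iteratedFDeriv_le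
  obtain ⟨W, hW0, hW⟩ := exists_norm_iteratedFDeriv_covSlice_comp_le χ hM he hK
  -- one increasing family of constants: `Γ_s = M² + Σ_{i ≤ s} W_i`
  set Γ : ℕ → ℝ := fun s => M ^ 2 + ∑ i ∈ Finset.range (s + 1), W i with hΓ
  have hΓW : ∀ i, W i ≤ Γ i := fun i => by
    have h1 : W i ≤ ∑ i' ∈ Finset.range (i + 1), W i' :=
      Finset.single_le_sum (fun i' _ => hW0 i') (Finset.mem_range.2 (Nat.lt_succ_self i))
    have h2 : 0 ≤ M ^ 2 := sq_nonneg M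
    simp only [hΓ]; linarith
  have hΓM : ∀ s, M ^ 2 ≤ Γ s := fun s => by
    have := Finset.sum_nonneg (fun i (_ : i ∈ Finset.range (s + 1)) => hW0 i)
    simp only [hΓ]; linarith
  have hΓ0 : ∀ s, 0 ≤ Γ s := fun s => (sq_nonneg M).trans (hΓM s)
  have hΓmono : Monotone Γ := by
    intro s t hst
    have hsum : ∑ i ∈ Finset.range (s + 1), W i ≤ ∑ i ∈ Finset.range (t + 1), W i :=
      Finset.sum_le_sum_of_subset_of_nonneg (Finset.range_mono (Nat.succ_le_succ hst))
        fun i _ _ => hW0 i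
    simp only [hΓ]
    linarith
  refine ⟨Γ, hΓmono, hΓ0, fun j hj => ⟨?_, ?_, ?_, ?_⟩⟩
  · -- `C^{k-1}` (indeed `C^k`)
    have hι : ContDiff ℝ k (fun q : ℝ × E => ((q.1, e q.2) : ℝ × ℝ)) :=
      contDiff_fst.prodMk (he.comp contDiff_snd)
    have hg : ContDiff ℝ k (fun q : ℝ × ℝ => χ.covSlice j q.1 q.2) :=
      (χ.contDiff_covSlice hM j).of_le (by exact_mod_cast le_top)
    have hk := hg.comp hι
    have hle : ((k - 1 : ℕ) : WithTop ℕ∞) ≤ (k : WithTop ℕ∞) := by exact_mod_cast Nat.sub_le k 1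
    have hfun : (fun q : ℝ × E => χ.covSlice j q.1 (e q.2)) =
        (fun q : ℝ × ℝ => χ.covSlice j q.1 q.2) ∘ (fun q : ℝ × E => ((q.1, e q.2) : ℝ × ℝ)) := rfl
    rw [hfun]
    exact hk.of_le hle
  · -- periodicity
    intro γ hγ p₀ q
    rw [hA2.periodic γ hγ q]
  · -- (onlyyou) with `ν = 1`
    intro i hi q
    have hik : i ≤ k := hi.trans (Nat.sub_le k 1)
    have h1 := hW i hik j hj q.1 q.2
    have hexp : M ^ (-((i + 1 : ℕ) : ℤ) * j) = M ^ (-(j : ℝ) * (1 + i)) := by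
      rw [← Real.rpow_intCast]
      congr 1
      push_cast
      ring
    rw [← hexp]
    refine h1.trans ?_
    exact mul_le_mul_of_nonneg_right (mul_le_mul_of_nonneg_right (hΓW i) (zpow_pos hM0 _).le)
      (scaleInd_mem_Icc M j q.1 (e q.2)).1
  · -- (thunif) with `ν = 1`: the string is constant in `θ` along the coordinate lines
    intro s hs p₀ ρ θ hρ
    have hρ' : ρ ∈ Set.Ioo (-(2 * r₀)) (2 * r₀) := by
      constructor <;> cases abs_lt.1 hρ <;> linarith
    have hconst : (fun θ' => χ.covSlice j p₀ (e (Φ.p ρ θ'))) = fun _ => χ.covSlice j p₀ ρ := by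
      funext θ'
      rw [Φ.level θ' ρ hρ']
    rw [hconst, iteratedDeriv_const]
    have hexp : M ^ (-(1 : ℝ) * j) = M ^ (-j) := by
      rw [show (-(1 : ℝ) * j) = ((-j : ℤ) : ℝ) by push_cast; ring, Real.rpow_intCast]
    rw [hexp]
    split_ifs with hs0
    · refine (χ.norm_covSlice_le hM j p₀ ρ).trans ?_
      exact mul_le_mul_of_nonneg_right (mul_le_mul_of_nonneg_right (hΓM s) (zpow_pos hM0 _).le)
        (scaleInd_mem_Icc M j p₀ ρ).1
    · rw [norm_zero]
      exact mul_nonneg (mul_nonneg (hΓ0 s) (zpow_pos hM0 _).le) (scaleInd_mem_Icc M j p₀ ρ).1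

end Strings

/-! ### [I] Lemma 2.3 (ii): the volume of a thin shell and the `L¹` norm of a slice, `d = 2` [I p.14 L106-129] -/

section ShellVolume

open MeasureTheory Function
open scoped ENNReal InnerProductSpace Pointwise

variable {E : Type*} [NormedAddCommGroup E] [InnerProductSpace ℝ E] [CompleteSpace E]
  [FiniteDimensional ℝ E] [MeasurableSpace E] [BorelSpace E]
  {cr : Crystal E} {e : E → ℝ} {k : ℕ} {r₀ : ℝ}

omit [CompleteSpace E] [FiniteDimensional ℝ E] [BorelSpace E] in
/-- The fundamental domain `F` of a crystal (a set of unique representatives of `E/Γ#`) is a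
measure-theoretic fundamental domain for the translation action of `Γ#` once it is measurable. [folklore] -/
private theorem Crystal.isAddFundamentalDomain (cr : Crystal E) (hF : MeasurableSet cr.fundamentalDomain)
    (μ : Measure E) : IsAddFundamentalDomain cr.dualLattice cr.fundamentalDomain μ := by
  refine IsAddFundamentalDomain.mk' hF.nullMeasurableSet fun x => ?_
  have h := cr.existsUnique_rep x
  refine ⟨h.exists.choose, ?_, fun g hg => h.unique ?_ h.exists.choose_spec⟩
  · show h.exists.choose +ᵥ x ∈ cr.fundamentalDomain
    rw [Submodule.vadd_def, vadd_eq_add, add_comm]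
    exact h.exists.choose_spec
  · have hg' : g +ᵥ x ∈ cr.fundamentalDomain := hg
    rwa [Submodule.vadd_def, vadd_eq_add, add_comm] at hg'

/-- **The volume of a thin shell around the Fermi curve is `O(ε)`** ([I] Lemma 2.3 (ii), first display:
"`∫_𝓑 d^d p 𝟙(|e(p)| ≤ ε) ≤ (A/u₀) ε`", p.14 L106–113, with `A = max{1, 2A₀ ∫_S dω}`, `A₀/u₀` the
Jacobian bound of Lemma 2.1 (iv); [II] §2.5 p.11 L23–26: "the support of `C_j` is contained in … a
thin shell of thickness `M^j` around the Fermi surface"). In `d = 2`, for any coordinate datum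
`Φ : TubularCoords cr e k r₀` (`k ≥ 1`) and a measurable fundamental domain `F`: there is `C ≥ 0`
with `vol{q ∈ F : |e(q)| ≤ ε} ≤ C ε` for all `0 ≤ ε ≤ r₀` — by the change of variables
`q = p(ρ, θ)` ([II] (JacobianJ)): the shell is covered by the `Γ#`-translates of
`p([-ε, ε] × [0, 2π])`, `F` is a fundamental domain, and the area formula bounds the volume of the
image by `sup|J| · 2ε · 2π` (`MeasureTheory.addHaar_image_le_lintegral_abs_det_fderiv`).
[cite: FeldmanSalmhoferTrubowitz1996, Lemma 2.3 (ii) (arXiv p.14 L106-113)] -/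
theorem TubularCoords.exists_volume_shell_le (Φ : TubularCoords cr e k r₀)
    (hd : Module.finrank ℝ E = 2) (hk : 1 ≤ k) (hF : MeasurableSet cr.fundamentalDomain) :
    ∃ C : ℝ, 0 ≤ C ∧ ∀ ε ∈ Icc (0 : ℝ) r₀,
      volume {q ∈ cr.fundamentalDomain | |e q| ≤ ε} ≤ ENNReal.ofReal (C * ε) := by
  classical
  haveI : DiscreteTopology cr.dualLattice := cr.discrete
  haveI : IsZLattice ℝ cr.dualLattice := ⟨cr.span_eq_top⟩
  have hr₀ := Φ.r₀_pos
  -- an orthonormal frame of `E ≅ ℝ²` and the parameters `(ρ, θ) = (⟪b₀, x⟫, ⟪b₁, x⟫)` read in it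
  set b : OrthonormalBasis (Fin 2) ℝ E := (stdOrthonormalBasis ℝ E).reindex (finCongr hd) with hb
  set π : E →L[ℝ] ℝ × ℝ := (innerSL ℝ (b 0)).prod (innerSL ℝ (b 1)) with hπ
  have hπ_apply : ∀ x, π x = (⟪b 0, x⟫_ℝ, ⟪b 1, x⟫_ℝ) := fun x => rfl
  set f : E → E := fun x => Function.uncurry Φ.p (π x) with hf
  set R : ℝ → Set E := fun ε => π ⁻¹' (Icc (-ε) ε ×ˢ Icc 0 (2 * Real.pi)) with hR
  have hRmeas : ∀ ε, MeasurableSet (R ε) := fun ε =>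
    (measurableSet_Icc.prod measurableSet_Icc).preimage π.continuous.measurable
  -- the volume of the parameter box
  have hRvol : ∀ ε, 0 ≤ ε → volume (R ε) = ENNReal.ofReal (2 * ε) * ENNReal.ofReal (2 * Real.pi) := by
    intro ε hε
    set s : Fin 2 → Set ℝ := ![Icc (-ε) ε, Icc 0 (2 * Real.pi)] with hs
    have hset : R ε = b.repr ⁻¹' ((WithLp.ofLp : EuclideanSpace ℝ (Fin 2) → Fin 2 → ℝ) ⁻¹'
        Set.pi univ s) := by
      ext x
      simp only [hR, hs, mem_preimage, mem_prod, hπ_apply, mem_univ_pi, Fin.forall_fin_two,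
        Matrix.cons_val_zero, Matrix.cons_val_one, OrthonormalBasis.repr_apply_apply]
    have hsm : MeasurableSet (Set.pi univ s) :=
      MeasurableSet.univ_pi fun i => by fin_cases i <;> exact measurableSet_Icc
    rw [hset, b.measurePreserving_repr.measure_preimage
        ((hsm.preimage (PiLp.volume_preserving_ofLp (Fin 2)).measurable).nullMeasurableSet),
      (PiLp.volume_preserving_ofLp (Fin 2)).measure_preimage hsm.nullMeasurableSet, volume_pi_pi]
    simp only [hs, Fin.prod_univ_two, Matrix.cons_val_zero, Matrix.cons_val_one, Real.volume_Icc]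
    congr 1 <;> congr 1 <;> ring
  -- `f` is differentiable on the boxes, with derivative `Dp(π x) ∘ π`
  set U₀ : Set (ℝ × ℝ) := Ioo (-(2 * r₀)) (2 * r₀) ×ˢ univ with hU₀
  have hU₀open : IsOpen U₀ := isOpen_Ioo.prod isOpen_univ
  have hk1 : (1 : WithTop ℕ∞) ≤ k := by exact_mod_cast hk
  have hk0 : (k : WithTop ℕ∞) ≠ 0 := ne_of_gt (lt_of_lt_of_le zero_lt_one hk1)
  have hdiff : ∀ y ∈ U₀, HasFDerivAt (Function.uncurry Φ.p) (fderiv ℝ (Function.uncurry Φ.p) y) y :=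
    fun y hy => ((Φ.contDiffOn.differentiableOn hk0).differentiableAt (hU₀open.mem_nhds hy)).hasFDerivAt
  set f' : E → E →L[ℝ] E := fun x => (fderiv ℝ (Function.uncurry Φ.p) (π x)).comp π with hf'
  have hRU : ∀ ε ∈ Icc (0 : ℝ) r₀, ∀ x ∈ R ε, π x ∈ Icc (-r₀) r₀ ×ˢ Icc 0 (2 * Real.pi) := by
    intro ε hε x hx
    simp only [hR, mem_preimage, mem_prod, mem_Icc] at hx
    exact ⟨⟨by linarith [hx.1.1, hε.2], by linarith [hx.1.2, hε.2]⟩, hx.2⟩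
  have hKU : Icc (-r₀) r₀ ×ˢ Icc 0 (2 * Real.pi) ⊆ U₀ := fun y hy =>
    ⟨⟨by linarith [hy.1.1], by linarith [hy.1.2]⟩, mem_univ _⟩
  have hfd : ∀ ε ∈ Icc (0 : ℝ) r₀, ∀ x ∈ R ε, HasFDerivWithinAt f (f' x) (R ε) x :=
    fun ε hε x hx => ((hdiff _ (hKU (hRU ε hε x hx))).comp x π.hasFDerivAt).hasFDerivWithinAt
  -- the Jacobian is bounded on the largest box
  have hcont : ContinuousOn (fun y : ℝ × ℝ => ((fderiv ℝ (Function.uncurry Φ.p) y).comp π).det)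
      (Icc (-r₀) r₀ ×ˢ Icc 0 (2 * Real.pi)) := by
    have h1 : ContinuousOn (fderiv ℝ (Function.uncurry Φ.p)) U₀ :=
      Φ.contDiffOn.continuousOn_fderiv_of_isOpen hU₀open hk1
    exact ContinuousLinearMap.continuous_det.comp_continuousOn
      ((h1.mono hKU).clm_comp continuousOn_const)
  obtain ⟨J, hJ⟩ := ((isCompact_Icc.prod isCompact_Icc).exists_bound_of_continuousOn hcont)
  have hJ0 : 0 ≤ J := le_trans (norm_nonneg _) (hJ (0, 0) ⟨⟨by linarith, by linarith⟩,
    ⟨le_rfl, by positivity⟩⟩)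
  have hdet : ∀ ε ∈ Icc (0 : ℝ) r₀, ∀ x ∈ R ε, |(f' x).det| ≤ J := fun ε hε x hx => by
    simpa only [Real.norm_eq_abs] using hJ (π x) (hRU ε hε x hx)
  -- `F` is a fundamental domain for `Γ#`
  have hFD := Crystal.isAddFundamentalDomain cr hF (volume : Measure E)
  haveI : MeasurableVAdd cr.dualLattice E :=
    (inferInstance : MeasurableVAdd cr.dualLattice.toAddSubgroup E)
  haveI : VAddInvariantMeasure cr.dualLattice E (volume : Measure E) :=
    (inferInstance : VAddInvariantMeasure cr.dualLattice.toAddSubgroup E volume)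
  -- the shell is covered by the translates of the image of the box
  have hcover : ∀ ε ∈ Icc (0 : ℝ) r₀, {q ∈ cr.fundamentalDomain | |e q| ≤ ε} ⊆
      ⋃ g : cr.dualLattice, (g +ᵥ (f '' R ε)) ∩ cr.fundamentalDomain := by
    intro ε hε q hq
    obtain ⟨hqF, hqe⟩ := hq
    have hq2 : |e q| < 2 * r₀ := lt_of_le_of_lt hqe (by linarith [hε.2])
    obtain ⟨γ, hγ, θ, hθ⟩ := Φ.covers q hq2
    set θ' : ℝ := toIcoMod Real.two_pi_pos 0 θ with hθ'
    have hθ'mem : θ' ∈ Ico 0 (2 * Real.pi) := toIcoMod_mem_Ico' Real.two_pi_pos θ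
    have hpθ' : Φ.p (e q) θ' = Φ.p (e q) θ := by
      rw [hθ', ← self_sub_toIcoDiv_zsmul]
      exact (Φ.periodic (e q)).sub_zsmul_eq _
    set x : E := (e q) • b 0 + θ' • b 1 with hx
    have hb := orthonormal_iff_ite.1 b.orthonormal
    have hπx : π x = (e q, θ') := by
      rw [hπ_apply, hx]
      simp only [inner_add_right, inner_smul_right, hb]
      simp
    refine mem_iUnion.2 ⟨-⟨γ, hγ⟩, ⟨?_, hqF⟩⟩
    refine Set.mem_vadd_set.2 ⟨f x, ⟨x, ?_, rfl⟩, ?_⟩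
    · simp only [hR, mem_preimage, hπx, mem_prod, mem_Icc]
      exact ⟨abs_le.1 hqe, hθ'mem.1, hθ'mem.2.le⟩
    · rw [Submodule.vadd_def, vadd_eq_add, hf]
      simp only [Function.uncurry, hπx, hpθ', hθ]
      simp
  -- assemble
  refine ⟨J * (2 * (2 * Real.pi)), by positivity, fun ε hε => ?_⟩
  calc volume {q ∈ cr.fundamentalDomain | |e q| ≤ ε}
      ≤ volume (⋃ g : cr.dualLattice, (g +ᵥ (f '' R ε)) ∩ cr.fundamentalDomain) :=
        measure_mono (hcover ε hε)
    _ ≤ ∑' g : cr.dualLattice, volume ((g +ᵥ (f '' R ε)) ∩ cr.fundamentalDomain) :=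
        measure_iUnion_le _
    _ = volume (f '' R ε) := (hFD.measure_eq_tsum (f '' R ε)).symm
    _ ≤ ∫⁻ x in R ε, ENNReal.ofReal |(f' x).det| :=
        addHaar_image_le_lintegral_abs_det_fderiv volume (hRmeas ε) (hfd ε hε)
    _ ≤ ∫⁻ x in R ε, ENNReal.ofReal J :=
        setLIntegral_mono measurable_const fun x hx => ENNReal.ofReal_le_ofReal (hdet ε hε x hx)
    _ = ENNReal.ofReal J * volume (R ε) := setLIntegral_const _ _
    _ = ENNReal.ofReal (J * (2 * (2 * Real.pi)) * ε) := by
        rw [hRvol ε hε.1, ← ENNReal.ofReal_mul (by linarith [hε.1] : (0 : ℝ) ≤ 2 * ε),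
          ← ENNReal.ofReal_mul hJ0]
        congr 1
        ring

/-- **The `L¹` norm of a slice is `O(M^j)`** ([I] Lemma 2.3 (ii), (Cjpbd)/(Kzerodef):
"`|C_j|' = ∫_{ℝ×𝓑} dp₀ d𝐩 |C_j(p₀, e(𝐩))| ≤ (2AM²/u₀) M^j` … taking `K₀ = 2AM²/u₀`, `|C_j|' ≤ K₀ M^j`",
p.14 L115–129). In `d = 2`, for a coordinate datum `Φ : TubularCoords cr e k r₀` (`k ≥ 1`), a
continuous band, a measurable fundamental domain `F` and a cutoff with `M > 1`: with the shell-volume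
constant `C` of `exists_volume_shell_le` (in place of `A/u₀`) and `K₀ = 2CM²`,
`∫_{ℝ×F} |C_j(p₀, e(𝐩))| ≤ K₀ M^j` for every scale `j` with `M^j ≤ r₀` (all `j ≤ -1` once
`M ≥ r₀⁻¹`, [II] §2.4) — from (shellj)₀ `|C_j| ≤ M² M^{-j} 𝟙(|p₀| ≤ M^j) 𝟙(|e| ≤ M^j)` and Tonelli.
[cite: FeldmanSalmhoferTrubowitz1996, Lemma 2.3 (ii) eqs. (Cjpbd), (Kzerodef) (arXiv p.14 L115-129)] -/
theorem TubularCoords.exists_lintegral_covSlice_le (Φ : TubularCoords cr e k r₀)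
    (hd : Module.finrank ℝ E = 2) (hk : 1 ≤ k) (he : Continuous e)
    (hF : MeasurableSet cr.fundamentalDomain) {M : ℝ} (χ : ScaleCutoff M) (hM : 1 < M) :
    ∃ K₀ : ℝ, 0 ≤ K₀ ∧ ∀ j : ℤ, M ^ j ≤ r₀ →
      ∫⁻ q in (univ : Set ℝ) ×ˢ cr.fundamentalDomain, ‖χ.covSlice j q.1 (e q.2)‖ₑ ≤
        ENNReal.ofReal (K₀ * M ^ j) := by
  obtain ⟨C, hC0, hC⟩ := Φ.exists_volume_shell_le hd hk hF
  have hM0 : 0 < M := zero_lt_one.trans hM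
  refine ⟨2 * C * M ^ 2, by positivity, fun j hj => ?_⟩
  have hMj : 0 < M ^ j := zpow_pos hM0 j
  have hsq : M ^ (2 * j) = (M ^ j) ^ 2 := by
    rw [← zpow_natCast, ← zpow_mul]
    congr 1
    push_cast
    ring
  set T : Set E := {q ∈ cr.fundamentalDomain | |e q| ≤ M ^ j} with hT
  have hTmeas : MeasurableSet T :=
    hF.inter (measurableSet_le he.abs.measurable measurable_const)
  set B : Set (ℝ × E) := Icc (-(M ^ j)) (M ^ j) ×ˢ T with hB
  have hBmeas : MeasurableSet B := measurableSet_Icc.prod hTmeas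
  set c : ℝ := M ^ 2 * M ^ (-j) with hc
  have hc0 : 0 ≤ c := by positivity
  -- pointwise: `|C_j(p₀, e(𝐩))| ≤ M² M^{-j} 𝟙_B` on `ℝ × F`
  have hbound : ∀ q ∈ (univ : Set ℝ) ×ˢ cr.fundamentalDomain,
      ‖χ.covSlice j q.1 (e q.2)‖ₑ ≤ ENNReal.ofReal c * B.indicator 1 q := by
    intro q hq
    by_cases h0 : χ.covSlice j q.1 (e q.2) = 0
    · simp [h0]
    obtain ⟨-, hhi⟩ := χ.sq_lt_of_covSlice_ne_zero hM h0
    rw [hsq] at hhi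
    have h1 : |q.1| ≤ M ^ j :=
      (abs_lt_of_sq_lt_sq (by nlinarith [sq_nonneg (e q.2)]) hMj.le).le
    have h2 : |e q.2| ≤ M ^ j :=
      (abs_lt_of_sq_lt_sq (by nlinarith [sq_nonneg q.1]) hMj.le).le
    have hqB : q ∈ B := ⟨abs_le.1 h1, (mem_prod.1 hq).2, h2⟩
    rw [indicator_of_mem hqB, Pi.one_apply, mul_one, ← ofReal_norm]
    apply ENNReal.ofReal_le_ofReal
    calc ‖χ.covSlice j q.1 (e q.2)‖ ≤ M ^ 2 * M ^ (-j) * scaleInd M j q.1 (e q.2) :=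
          χ.norm_covSlice_le hM j _ _
      _ ≤ M ^ 2 * M ^ (-j) * 1 := by
          gcongr
          exact (scaleInd_mem_Icc M j _ _).2
      _ = c := mul_one _
  calc ∫⁻ q in (univ : Set ℝ) ×ˢ cr.fundamentalDomain, ‖χ.covSlice j q.1 (e q.2)‖ₑ
      ≤ ∫⁻ q in (univ : Set ℝ) ×ˢ cr.fundamentalDomain, ENNReal.ofReal c * B.indicator 1 q :=
        setLIntegral_mono' (MeasurableSet.univ.prod hF) hbound
    _ ≤ ∫⁻ q, ENNReal.ofReal c * B.indicator 1 q := setLIntegral_le_lintegral _ _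
    _ = ENNReal.ofReal c * volume B := by
        rw [lintegral_const_mul' _ _ ENNReal.ofReal_ne_top, lintegral_indicator_one hBmeas]
    _ = ENNReal.ofReal c * (volume (Icc (-(M ^ j)) (M ^ j)) * volume T) := by
        rw [hB, Measure.volume_eq_prod, Measure.prod_prod]
    _ ≤ ENNReal.ofReal c * (ENNReal.ofReal (2 * M ^ j) * ENNReal.ofReal (C * M ^ j)) := by
        gcongr
        · rw [Real.volume_Icc]
          apply le_of_eq
          congr 1
          ring
        · exact hC _ ⟨hMj.le, hj⟩
    _ = ENNReal.ofReal (2 * C * M ^ 2 * M ^ j) := by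
        rw [← ENNReal.ofReal_mul (by positivity), ← ENNReal.ofReal_mul hc0]
        congr 1
        have hzz : M ^ (-j) * M ^ j = 1 := by rw [zpow_neg, inv_mul_cancel₀ hMj.ne']
        calc c * (2 * M ^ j * (C * M ^ j)) = 2 * C * M ^ 2 * M ^ j * (M ^ (-j) * M ^ j) := by
              rw [hc]; ring
          _ = 2 * C * M ^ 2 * M ^ j := by rw [hzz, mul_one]

/-- **[I] Lemma 2.3 (ii), first display, for every band of [II] §2 in `d = 2`** — the datum-free form:
under (A2)_{k,h} (`k ≥ 2`), (A3) global and the geometric constants `GeomConstants e K r₀ g₀ wmin` of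
[II] §2.1–2.2, for a measurable fundamental domain `F` there is `C ≥ 0` with
`vol{q ∈ F : |e(q)| ≤ ε} ≤ C ε` for all `0 ≤ ε ≤ r₀/2` (through the coordinates of
`nonempty_tubularCoords`, `FST2TubularCoordsConstruction.lean`, which have radius `r₀/2`).
[cite: FeldmanSalmhoferTrubowitz1996, Lemma 2.3 (ii) (arXiv p.14 L106-113)] -/
theorem exists_volume_shell_le_of_geomConstants (cr : Crystal E) (hd : Module.finrank ℝ E = 2)
    {h : ℝ≥0} (hk : 2 ≤ k) (hA2 : HypA2 cr k h e) (hG : HypA3Global cr e) {K g₀ wmin : ℝ}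
    (hgc : GeomConstants e K r₀ g₀ wmin) (hF : MeasurableSet cr.fundamentalDomain) :
    ∃ C : ℝ, 0 ≤ C ∧ ∀ ε ∈ Icc (0 : ℝ) (r₀ / 2),
      volume {q ∈ cr.fundamentalDomain | |e q| ≤ ε} ≤ ENNReal.ofReal (C * ε) := by
  obtain ⟨Φ⟩ := nonempty_tubularCoords cr hd hk hA2 hG hgc
  exact Φ.exists_volume_shell_le hd (le_trans one_le_two hk) hF

/-- **[I] Lemma 2.3 (ii), (Cjpbd)/(Kzerodef), for every band of [II] §2 in `d = 2`** — the datum-free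
form: under (A2)_{k,h} (`k ≥ 2`), (A3) global, `GeomConstants e K r₀ g₀ wmin`, a measurable `F` and a
cutoff with `M > 1`, there is `K₀ ≥ 0` with `∫_{ℝ×F} |C_j(p₀, e(𝐩))| ≤ K₀ M^j` for every scale `j` with
`M^j ≤ r₀/2` (all `j ≤ -1` once `M ≥ 2/r₀`).
[cite: FeldmanSalmhoferTrubowitz1996, Lemma 2.3 (ii) eqs. (Cjpbd), (Kzerodef) (arXiv p.14 L115-129)] -/
theorem exists_lintegral_covSlice_le_of_geomConstants (cr : Crystal E) (hd : Module.finrank ℝ E = 2)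
    {h : ℝ≥0} (hk : 2 ≤ k) (hA2 : HypA2 cr k h e) (hG : HypA3Global cr e) {K g₀ wmin : ℝ}
    (hgc : GeomConstants e K r₀ g₀ wmin) (hF : MeasurableSet cr.fundamentalDomain) {M : ℝ}
    (χ : ScaleCutoff M) (hM : 1 < M) :
    ∃ K₀ : ℝ, 0 ≤ K₀ ∧ ∀ j : ℤ, M ^ j ≤ r₀ / 2 →
      ∫⁻ q in (univ : Set ℝ) ×ˢ cr.fundamentalDomain, ‖χ.covSlice j q.1 (e q.2)‖ₑ ≤
        ENNReal.ofReal (K₀ * M ^ j) := by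
  obtain ⟨Φ⟩ := nonempty_tubularCoords cr hd hk hA2 hG hgc
  exact Φ.exists_lintegral_covSlice_le hd (le_trans one_le_two hk) hA2.memContDiffHolder.1.continuous
    hF χ hM

end ShellVolume

end Literature.MathematicalPhysics.QuantumLattice.FermiRG

end
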